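import Literature.NumberTheory.Automorphic.Liu2021.LemD1AsPrintedIndexedNonVacuityInertConverse
import Literature.NumberTheory.EllipticCurves.HeegnerPointsKolyvaginProp81FrobeniusProofs
import Literature.NumberTheory.EllipticCurves.HeegnerPointsOfConductor
import HarnessLib

/-!
# At an inert Kolyvagin prime `λ`, complex conjugation on `K_λ` moves every `p`-th root of unity
# (Gross 1991, (3.3): `Frob(ℓ)` acts on `μ_p` as `ζ ↦ ζ^ℓ = ζ⁻¹`)

Topic `NumberTheory/EllipticCurves` (Kolyvagin-prime bookkeeping); namespace
`Literature.NumberTheory.EllipticCurves`. THEOREMS ONLY: no definition, no named fact, no `sorry`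
(D-0026).

Let `K` be a quadratic number field with non-trivial automorphism `τ`, `ℓ` a rational prime INERT
in `K` (`(ℓ) = ℓ 𝓞_K` prime), `λ = (ℓ)` its place (so `τ • λ = λ`), and
`τ_λ = galAdicCompletionMap τ _ : K_λ → K_λ` the Galois transport of `τ` to the completion (the
continuous extension of `τ`; Cassels–Fröhlich VII §1.1). The tree's
`…Liu2021.LemD1IndexedNonVacuityInertConverse.galAdicCompletionMap_eq_pow_of_pow_eq_one` (Neukirch I §9
Ex. 2, II (5.3): *the conjugation of the completion at an inert unramified place is the
`q_v`-Frobenius on the prime-to-`ℓ` roots of unity*) gives `τ_λ(ζ) = ζ^ℓ` for every `ζ ∈ K_λ` with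
`ζ^p = 1`, `p ≠ ℓ`. Hence:

* `galAdicCompletionMap_ne_self_of_pow_eq_one` — if `p ∤ ℓ − 1` then `τ_λ ζ ≠ ζ` for every
  `ζ ∈ K_λ` with `ζ^p = 1`, `ζ ≠ 1`;
* `galAdicCompletionMap_ne_self_of_dvd_add_one` — in particular at a KOLYVAGIN prime (`p` odd,
  `p ∣ ℓ + 1`, Gross (3.3); then `p ∤ ℓ − 1`), e.g. for `Zhang2014.IsKolyvaginPrime N W K p ℓ`
  (`galAdicCompletionMap_ne_self_of_zhang_isKolyvaginPrime`).

Use (road K of the tree's JET cell, Jetchev 2008 §3.2 (2)): the lift of `τ` adapted to `λ` cannot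
act as a scalar `±1` on `E[p]` — it would then fix the values `μ_p` of the Weil pairing, which lie
in `K_λ` when `Γ_{K_λ}` fixes `E[p]`; this is the non-scalarity hypothesis of
`WeierstrassCurve.natCard_ker_map_sub_smul_quotient_adicCompletion_eq`
(`LocalPointsPrimaryQuotientEigenparts.lean`).

## References
* [GrossLMS1991] B. H. Gross, *Kolyvagin's work on modular elliptic curves* (1991), §3 (3.2)–(3.3).
* [NeukirchANT1999] J. Neukirch, *Algebraic Number Theory* (1999), Ch. I §9 Exercise 2, Ch. II §5
  Prop. (5.3).
* [CasselsFrohlichANT1967] Cassels–Fröhlich (eds.), *Algebraic Number Theory* (1967), Ch. VII §1.1.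
* [WZhang2014] W. Zhang, Camb. J. Math. 2 (2014), Notations (xii).
-/

noncomputable section

open scoped Classical

namespace Literature.NumberTheory.EllipticCurves

open NumberField IsDedekindDomain Literature.NumberTheory.Automorphic
open Literature.NumberTheory.Automorphic.Liu2021.LemD1IndexedNonVacuityInertConverse

-- `K : Type`: the tree's Galois transport of completions for `E/F` quadratic is universe `0`.
variable {K : Type} [Field K] [NumberField K] [Algebra.IsQuadraticExtension ℚ K]

/-- **`τ_λ` moves every non-trivial `p`-th root of unity of `K_λ` when `p ∤ ℓ − 1`** (`ℓ` inert in the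
quadratic field `K`, `τ ≠ 1`, `p ≠ ℓ`): `τ_λ ζ = ζ^ℓ` (Neukirch I §9 Ex. 2 / II (5.3); tree
`galAdicCompletionMap_eq_pow_of_pow_eq_one`), and `ζ^ℓ = ζ` with `ζ^p = 1`, `p ∤ ℓ − 1` forces `ζ = 1`.
[cite: NeukirchANT1999, Ch. I §9 Exercise 2 and Ch. II §5 Prop. (5.3)] [cite: GrossLMS1991, §3 (3.3)] -/
theorem galAdicCompletionMap_ne_self_of_pow_eq_one (τ : K ≃ₐ[ℚ] K) (hτ : τ ≠ 1) {ℓ : ℕ}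
    (hℓ : ℓ.Prime) (hinert : (Ideal.span {(ℓ : 𝓞 K)}).IsPrime) {w : HeightOneSpectrum (𝓞 K)}
    (hℓw : (ℓ : 𝓞 K) ∈ w.asIdeal) (hfix : τ • w = w) {p : ℕ} (hp : p.Prime) (hpℓ : p ≠ ℓ)
    (hpl : ¬ p ∣ ℓ - 1) {ζ : w.adicCompletion K} (hζ : ζ ^ p = 1) (hζ1 : ζ ≠ 1) :
    galAdicCompletionMap τ hfix ζ ≠ ζ := by
  -- the place `v = (ℓ)` of `ℚ` below `w`, unramified in `K`
  set v : HeightOneSpectrum (𝓞 ℚ) := w.under (𝓞 ℚ) with hv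
  have hℓv : (ℓ : 𝓞 ℚ) ∈ v.asIdeal := by
    change (ℓ : 𝓞 ℚ) ∈ w.asIdeal.under (𝓞 ℚ)
    rw [Ideal.under_def, Ideal.mem_comap, map_natCast]
    exact hℓw
  have hunr : Algebra.IsUnramifiedIn (𝓞 K) v.asIdeal :=
    isUnramifiedIn_of_span_natCast_isPrime hℓ hinert hℓv
  -- `#(ℤ / v) = ℓ`
  have hq : Nat.card (𝓞 ℚ ⧸ v.asIdeal) = ℓ := by
    rw [← HeightOneSpectrum.residueCard_eq_card_quotient, HeightOneSpectrum.residueCard,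
      ← span_natCast_rat_eq hℓ hℓv, Ideal.absNorm_span_singleton,
      show (ℓ : 𝓞 ℚ) = algebraMap ℤ (𝓞 ℚ) (ℓ : ℤ) by simp, Algebra.norm_algebraMap,
      NumberField.RingOfIntegers.rank, Module.finrank_self, pow_one, Int.natAbs_natCast]
  -- `v_w(p) = 1`
  have hpw : (p : 𝓞 K) ∉ w.asIdeal := not_natCast_mem_of_prime_ne hℓ hp hpℓ.symm w hℓw
  have hpv : Valued.v ((p : w.adicCompletion K)) = 1 := by
    have h1 : ((p : w.adicCompletion K)) = (((p : 𝓞 K) : K) : w.adicCompletion K) := by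
      rw [show (((p : 𝓞 K) : K)) = (p : K) by norm_cast]
      exact (map_natCast (algebraMap K (w.adicCompletion K)) p).symm
    rw [h1, HeightOneSpectrum.valuedAdicCompletion_eq_valuation', RingOfIntegers.coe_eq_algebraMap]
    exact le_antisymm (HeightOneSpectrum.valuation_le_one w _)
      (not_lt.mp fun h => hpw ((HeightOneSpectrum.valuation_lt_one_iff_mem w _).mp h))
  -- `τ_λ ζ = ζ^ℓ`
  have key := galAdicCompletionMap_eq_pow_of_pow_eq_one K τ v hτ hunr ⟨w, rfl⟩ hfix hp.ne_zero hpv hζ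
  rw [hq] at key
  intro hfixζ
  rw [hfixζ] at key
  -- `ζ^ℓ = ζ`, `ζ^p = 1`, `p ∤ ℓ - 1` force `ζ = 1`
  have hζ0 : ζ ≠ 0 := fun h => by
    rw [h, zero_pow hp.ne_zero] at hζ; exact zero_ne_one hζ
  have hℓ1 : ζ ^ (ℓ - 1) = 1 := by
    have h : ζ ^ (ℓ - 1) * ζ = 1 * ζ := by
      rw [← pow_succ, Nat.sub_add_cancel hℓ.one_le, ← key, one_mul]
    exact mul_right_cancel₀ hζ0 h
  have hord : orderOf ζ ∣ p := orderOf_dvd_of_pow_eq_one hζ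
  rcases (Nat.dvd_prime hp).mp hord with h1 | h1
  · exact hζ1 (orderOf_eq_one_iff.mp h1)
  · exact hpl (h1 ▸ orderOf_dvd_of_pow_eq_one hℓ1)

/-- **At a Kolyvagin prime** (`p` odd, `p ∣ ℓ + 1` — Gross 1991 (3.3); `ℓ` inert in `K`, `p ≠ ℓ`):
`τ_λ ζ ≠ ζ` for every `ζ ∈ K_λ` with `ζ^p = 1`, `ζ ≠ 1` (`τ_λ ζ = ζ^ℓ = ζ⁻¹`: *"`Frob(ℓ)` inverts
`μ_p`"*). [cite: GrossLMS1991, §3 (3.3)] [cite: NeukirchANT1999, Ch. I §9 Exercise 2] -/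
theorem galAdicCompletionMap_ne_self_of_dvd_add_one (τ : K ≃ₐ[ℚ] K) (hτ : τ ≠ 1) {ℓ : ℕ}
    (hℓ : ℓ.Prime) (hinert : (Ideal.span {(ℓ : 𝓞 K)}).IsPrime) {w : HeightOneSpectrum (𝓞 K)}
    (hℓw : (ℓ : 𝓞 K) ∈ w.asIdeal) (hfix : τ • w = w) {p : ℕ} (hp : p.Prime) (hp2 : p ≠ 2)
    (hpℓ : p ≠ ℓ) (hpl : p ∣ ℓ + 1) {ζ : w.adicCompletion K} (hζ : ζ ^ p = 1) (hζ1 : ζ ≠ 1) :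
    galAdicCompletionMap τ hfix ζ ≠ ζ := by
  refine galAdicCompletionMap_ne_self_of_pow_eq_one τ hτ hℓ hinert hℓw hfix hp hpℓ ?_ hζ hζ1
  intro h
  have h2 : p ∣ (ℓ + 1) - (ℓ - 1) := Nat.dvd_sub hpl h
  have : (ℓ + 1) - (ℓ - 1) = 2 := by have := hℓ.one_le; omega
  rw [this] at h2
  exact hp2 ((Nat.prime_dvd_prime_iff_eq hp Nat.prime_two).mp h2)

/-- **Zhang-currency form**: for a Kolyvagin prime `ℓ` in Zhang's sense (`Zhang2014.IsKolyvaginPrime N W K p ℓ`: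
`ℓ ∤ N d_K p`, `(ℓ)` prime in `𝓞 K`, `M(ℓ) > 0`, so `p ∣ ℓ + 1`) with `p` odd, `w` the place above
`ℓ` fixed by `τ ≠ 1`: `τ_λ` moves every non-trivial `p`-th root of unity of `K_λ`.
[cite: WZhang2014, Notations (xii)] [cite: GrossLMS1991, §3 (3.3)] -/
theorem galAdicCompletionMap_ne_self_of_zhang_isKolyvaginPrime (τ : K ≃ₐ[ℚ] K) (hτ : τ ≠ 1)
    {N : ℕ} {W : WeierstrassCurve ℚ} [W.IsGloballyMinimal] {p ℓ : ℕ} [Fact p.Prime] (hp2 : p ≠ 2)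
    (hℓ : Zhang2014.IsKolyvaginPrime N W K p ℓ) {w : HeightOneSpectrum (𝓞 K)}
    (hℓw : (ℓ : 𝓞 K) ∈ w.asIdeal) (hfix : τ • w = w) {ζ : w.adicCompletion K} (hζ : ζ ^ p = 1)
    (hζ1 : ζ ≠ 1) : galAdicCompletionMap τ hfix ζ ≠ ζ := by
  have hp : p.Prime := Fact.out
  have hM : 1 ≤ Zhang2014.kolyvaginIndex W p ℓ := hℓ.2.2.2.2.2
  obtain ⟨hpl, -⟩ := Zhang2014.le_kolyvaginIndex_iff.mp hM
  rw [pow_one] at hpl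
  exact galAdicCompletionMap_ne_self_of_dvd_add_one τ hτ hℓ.1 hℓ.2.2.2.2.1 hℓw hfix hp hp2
    (Ne.symm hℓ.2.2.2.1) hpl hζ hζ1

end Literature.NumberTheory.EllipticCurves

end
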